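import Summits.QuantumFields.BalabanUV.T4Continuum.Support.NE7AdmissibleFibreLHC
import Summits.QuantumFields.BalabanUV.T4Continuum.Support.AveragingDeficitChartCalculus
import Mathlib.Analysis.Calculus.ImplicitContDiff
import Mathlib.Analysis.Calculus.ContDiff.RCLike
import HarnessLib

/-!
# NE7FibreStraightening — A `C²` STRAIGHTENING OF THE ADMISSIBLE FIBRATION NEAR AN INTERIOR CONFIGURATION: at an interior `U₀ ∈ admissible (sfClass d L N ε) L (k+1) D₀`
# the `𝔲(n)` coordinate `Q̄(Φ) = levelQ L N k U₀ (chart_{U₀} Φ)` of the `(k+1)`-fold average is `C^m` at `0` for every `m` (row NE3-R2's submersion, upgraded from strict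
# differentiability to `ContDiffAt`), and the implicit function theorem (Mathlib `ContDiffAt.implicitFunction`, bivariate form, on `G(k + Rw) = y` with `R` a right inverse of
# the onto differential) gives `θ : (y, Φ) ↦ Φ + R·ψ(y, Φ)` with: `θ(0) = 0`, `θ` of class `C²` at `0`, Lipschitz on a ball, `Q̄(θ(y, Φ)) = y` (the fibre over the datum with
# coordinate `y`), `θ(Q̄ Φ, Φ) = Φ` (every nearby chart parameter is reached from its own fibre coordinate), and `chart_{U₀}(θ(y,Φ))` admissible over every unitary `N`-periodic
# datum `D` near `D₀` with `y(D) = y` — the geometric letter of gen 114's «4-POINT SCHEME» for the LIPSCHITZ dependence of `U_k(V)` on `V` (with `NE7RectangleSecondOrder`)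

Cell `pub-balaban`, rung (B)+1 sub-cell t4, lineage `b2b-balaban-t4-ne7-p1` (CRUX PROVER NE7 #1 = OWNER of BINDER row NE7), generation 114.  Memo
`t4/b2b-balaban-t4-ne7-p1-g114/ROAD-G114.md` §2.  Same ingredients as ✓ p820258 `NE7AdmissibleFibreQuantitativeBase` (row NE3-R2's `levelQ'_onto`, the class radius
`eventually_smallField_chart`, the decoding `eq_of_skewPR_relLog_eq`), with Mathlib's `ContDiffAt.implicitFunction` ∕ `contDiffAt_implicitFunction` in place of the nonlinear
right inverse.
WHAT ([folklore]; 0 def, 0 sorry; generic `d`, `L ≥ 1`).  `contDiffAt_levelQ` (every order `m`); **`fibre_straightening`** (statement in the theorem's docstring).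
HONEST FRAMING (page 1): soft finite-dimensional calculus; the Lipschitz constant and the radius are EXISTENTIAL and NOT uniform in `U₀`, `k`, `N`; nothing is asserted about
Bałaban's minimisers; NOT NE7, NOT NE3; spine 0∕9; finite T⁴ rung (B)+1 — NOT infinite volume, NOT mass gap, NOT BetaPertH, NOT Clay (continuum YM on T⁴ ⇐ BetaPertH ∧ nine
spine estimates).
-/

set_option autoImplicit false

open scoped BigOperators Matrix Matrix.Norms.L2Operator Topology NNReal
open NormedSpace Finset Set Filter Metric

namespace Summit.QuantumFields.BalabanUV.T4Continuum.NE7FibreStraightening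

open Literature.MathematicalPhysics.QuantumFieldTheory.Balaban1983to89
open B7Prop1Explicit B7Prop2Explicit MatrixLog UnitaryModel
open T4AveragingDeficitWall (IsUnitaryCfg IsSkewDir SmallField vary fineAction)
open T4AveragingDeficitWallBoundary (IsPeriodicCfg periodBox)
open AveragingDeficitPeriodicCounting (IsPeriodicDir)
open AveragingDeficitTorusChart (TDir redN chart chartDir chart_zero skewP skewP_of_mem skewP_mem isUnitaryCfg_chart isPeriodicCfg_chart)
open AveragingDeficitChartCalculus (cavg relLog relLog_self mlog_one contDiffAt_fineAction_chart coord coord_zero contDiffAt_coord)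
open AveragingDeficitFermat (eventually_smallField_chart isPeriodicCfg_cavg small512_of_liftSmall)
open AveragingDeficitTwoLevelPrep (skewSub mem_skewSub skewPF skewPR skewPF_of_mem skewPF_apply smallness_of_twoLevelSmall smallField_cavg cavg_isUnitaryCfg)
open AveragingDeficitMultiLevelPrep (tower cavgIter levelQ levelQ' levelQ_self levelQ_succ LevelSmall cavgIter_unitary_small isPeriodicCfg_cavgIter
  natCast_tower_succ tower_ne_zero ball_of_small eventually_cavg_chart_eq')
open AveragingDeficitMultiLevelFermat (hasStrictFDerivAt_levelQ levelQ'_onto continuousAt_cavgIter_chart)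
open AveragingDeficitMultiLevelBridge (cavgIter_eq_avgIter tower_eq)
open MinimalActionSandwich (admissible)
open MinimalActionRate (sfClass)
open NE7AdmissibleFibreLHC (continuous_chart chart_id_eq_chart_skewP eq_of_skewPR_relLog_eq tendsto_skewPR_relLog eventually_near_base period_succ_eq)

noncomputable section

variable {d : ℕ} {n : Type*} [Fintype n] [DecidableEq n]

/-! ## §1 The coordinate of the `(k+1)`-fold average is `C^m` in the chart parameter, every `m` -/

/-- **`levelQ j W₁ ∘ chart_id(W₁)` IS `C^m` AT `0` FOR EVERY `m`** for a unitary base `W₁` of period `L·tower j` in the small-field class (`LevelSmall j`) — row NE3-R2's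
`hasStrictFDerivAt_levelQ` with `ContDiffAt` in place of the strict derivative, same induction (base: `contDiffAt_coord` one level up composed with the linear `skewPR`;
step: the chain rule through `eventually_cavg_chart_eq'`). [folklore] -/
theorem contDiffAt_levelQ [Nonempty n] {m : WithTop ℕ∞} {L M' : ℕ} [NeZero L] [NeZero M'] (hL : 1 ≤ L) (j : ℕ) :
    ∀ {W₁ : Site d → Fin d → (Matrix n n ℂ)ˣ} {x : ℝ}, IsUnitaryCfg W₁ → IsPeriodicCfg W₁ ((L : ℤ) * (tower L M' j : ℕ)) →
      0 ≤ x → LevelSmall d L j x → SmallField W₁ x →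
        ContDiffAt ℝ m (fun Φ : TDir d n (L * tower L M' j) =>
          levelQ L M' j W₁ (chart (ContinuousLinearMap.id ℝ (Matrix n n ℂ)) (L * tower L M' j) W₁ Φ)) 0 := by
  induction j with
  | zero =>
      intro W₁ x hW₁ _ hx hs hW₁x
      have hcoord : ContDiffAt ℝ m (coord (ContinuousLinearMap.id ℝ (Matrix n n ℂ)) L M' W₁) 0 :=
        contDiffAt_coord (m := m) (ContinuousLinearMap.id ℝ (Matrix n n ℂ)) L M' W₁ (ball_of_small hL hW₁ hx hs hW₁x)
      exact (skewPR (d := d) (n := n) M').contDiff.contDiffAt.comp 0 hcoord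
  | succ j ih =>
      intro W₁ x hW₁ hW₁P hx hs hW₁x
      obtain ⟨hlift, hr0, -, -⟩ := smallness_of_twoLevelSmall (d := d) hL hx hs.1
      have h512 := small512_of_liftSmall hL hx hlift
      have hball := ball_of_small hL hW₁ hx hs.1 hW₁x
      have hW₁P' : IsPeriodicCfg (cavg L W₁) ((L : ℤ) * (tower L M' j : ℕ)) := by
        have h := isPeriodicCfg_cavg L (tower L M' (j + 1)) hW₁P
        rw [natCast_tower_succ] at h
        exact h
      have hcoord : ContDiffAt ℝ m (coord (ContinuousLinearMap.id ℝ (Matrix n n ℂ)) L (L * tower L M' j) W₁) 0 :=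
        contDiffAt_coord (m := m) (ContinuousLinearMap.id ℝ (Matrix n n ℂ)) L (L * tower L M' j) W₁ hball
      have hj := ih (cavg_isUnitaryCfg hL hW₁ hx h512 hW₁x) hW₁P' hr0 hs.2 (smallField_cavg hL hW₁ hx h512 hW₁x)
      rw [← coord_zero (ContinuousLinearMap.id ℝ (Matrix n n ℂ)) L (L * tower L M' j) W₁] at hj
      have hcomp := hj.comp 0 hcoord
      refine hcomp.congr_of_eventuallyEq ?_
      have hVP : IsPeriodicCfg W₁ ((L : ℤ) * (L * tower L M' j : ℕ)) := hW₁P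
      exact (eventually_cavg_chart_eq' (ContinuousLinearMap.id ℝ (Matrix n n ℂ)) (M := L * tower L M' j) hVP hball).mono
        fun Φ hΦ => by
          simp only [Function.comp, levelQ_succ, tower]
          rw [hΦ]


/-! ## §2 The `C²` straightening of the admissible fibration -/

set_option maxHeartbeats 800000 in
/-- **A `C²` STRAIGHTENING OF THE ADMISSIBLE FIBRATION NEAR AN INTERIOR CONFIGURATION.**  `L ≥ 1`, `ε ≥ 0`, `LevelSmall d L k (ε(L^{k+1})^{−2})`, `U₀ ∈ admissible
(sfClass d L N ε) L (k+1) D₀` interior (`SmallField U₀ a`, `a < ε(L^{k+1})^{−2}`); `M = L·tower L N k`, `Q̄ Φ := levelQ L N k U₀ (chart_id U₀ Φ)` on `Φ ∈ skewSub M`.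
THEN there are `θ : skewSub N × skewSub M → skewSub M`, `K ≥ 0`, `ρ₀ > 0` with: `θ 0 = 0`; `θ` is `C²` at `0`; `‖θ p − θ q‖ ≤ K‖p − q‖` for `‖p‖, ‖q‖ < ρ₀`;
`θ (Q̄ Φ, Φ) = Φ` for `‖Φ‖ < ρ₀`; and for `‖p‖ < ρ₀`: `Q̄ (θ p) = p.1`, `chart_id U₀ (θ p) ∈ sfClass d L N ε (k+1)`, and `chart_id U₀ (θ p) ∈ admissible (sfClass d L N ε) L
(k+1) D` for every unitary `N`-periodic datum `D` bondwise within `1∕4` of `D₀` whose coordinate `skewPR N (relLog N D₀ D)` is `p.1`. [folklore] -/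
theorem fibre_straightening [Nonempty n] {L N k : ℕ} [NeZero L] [NeZero N] (hL : 1 ≤ L) {ε a : ℝ} (hε : 0 ≤ ε)
    (hls : LevelSmall d L k (ε / ((L : ℝ) ^ (k + 1)) ^ 2)) {D₀ U₀ : Site d → Fin d → (Matrix n n ℂ)ˣ}
    (hU₀ : U₀ ∈ admissible (sfClass d L N ε) L (k + 1) D₀) (haε : a < ε / ((L : ℝ) ^ (k + 1)) ^ 2) (hU₀a : SmallField U₀ a) :
    ∃ (θ : ↥(skewSub d n N) × ↥(skewSub d n (L * tower L N k)) → ↥(skewSub d n (L * tower L N k))) (K ρ₀ : ℝ),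
      0 ≤ K ∧ 0 < ρ₀ ∧ θ 0 = 0 ∧ ContDiffAt ℝ 2 θ 0 ∧
      (∀ p q : ↥(skewSub d n N) × ↥(skewSub d n (L * tower L N k)), ‖p‖ < ρ₀ → ‖q‖ < ρ₀ → ‖θ p - θ q‖ ≤ K * ‖p - q‖) ∧
      (∀ Φ : ↥(skewSub d n (L * tower L N k)), ‖Φ‖ < ρ₀ →
        θ (levelQ L N k U₀ (chart (ContinuousLinearMap.id ℝ (Matrix n n ℂ)) (L * tower L N k) U₀ (Φ : TDir d n (L * tower L N k))), Φ) = Φ) ∧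
      (∀ p : ↥(skewSub d n N) × ↥(skewSub d n (L * tower L N k)), ‖p‖ < ρ₀ →
        levelQ L N k U₀ (chart (ContinuousLinearMap.id ℝ (Matrix n n ℂ)) (L * tower L N k) U₀ (θ p : TDir d n (L * tower L N k))) = p.1 ∧
        chart (ContinuousLinearMap.id ℝ (Matrix n n ℂ)) (L * tower L N k) U₀ (θ p : TDir d n (L * tower L N k)) ∈ sfClass d L N ε (k + 1) ∧
        ∀ D : Site d → Fin d → (Matrix n n ℂ)ˣ, IsUnitaryCfg D → IsPeriodicCfg D (N : ℤ) →
          (∀ (r : Fin d → Fin N) (κ' : Fin d),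
            ‖(((D₀ (boxVec N r) κ')⁻¹ : (Matrix n n ℂ)ˣ) : Matrix n n ℂ) * (D (boxVec N r) κ' : Matrix n n ℂ) - 1‖ ≤ 1 / 4) →
          skewPR N (relLog N D₀ D) = p.1 →
          chart (ContinuousLinearMap.id ℝ (Matrix n n ℂ)) (L * tower L N k) U₀ (θ p : TDir d n (L * tower L N k)) ∈ admissible (sfClass d L N ε) L (k + 1) D) := by
  set M : ℕ := L * tower L N k with hMdef
  set x : ℝ := ε / ((L : ℝ) ^ (k + 1)) ^ 2 with hxdef
  have hx : 0 ≤ x := by rw [hxdef]; positivity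
  obtain ⟨⟨hU₀u, hU₀P, hU₀x⟩, hU₀avg⟩ := hU₀
  have eP : ((N * L ^ (k + 1) : ℕ) : ℤ) = (L : ℤ) * (tower L N k : ℕ) := by rw [tower_eq]; push_cast; ring
  have ePM : ((N * L ^ (k + 1) : ℕ) : ℤ) = (M : ℤ) := by rw [hMdef]; push_cast; rw [tower_eq]; push_cast; ring
  have hU₀P' : IsPeriodicCfg U₀ ((L : ℤ) * (tower L N k : ℕ)) := by rw [← eP]; exact hU₀P
  have hU₀PM : IsPeriodicCfg U₀ (M : ℤ) := by rw [← ePM]; exact hU₀P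
  have hcD : cavgIter L (k + 1) U₀ = D₀ := by rw [cavgIter_eq_avgIter]; exact hU₀avg
  have hD₀u : IsUnitaryCfg D₀ := by
    obtain ⟨h, -, -⟩ := cavgIter_unitary_small hL k hU₀u hx hls hU₀x
    rwa [hcD] at h
  haveI : CompleteSpace ↥(skewSub d n M) := FiniteDimensional.complete ℝ _
  haveI : CompleteSpace ↥(skewSub d n N) := FiniteDimensional.complete ℝ _
  -- the constraint map in the chart: `C²` at `0`, strict derivative onto
  set G : ↥(skewSub d n M) → ↥(skewSub d n N) := fun Φ =>
    levelQ L N k U₀ (chart (ContinuousLinearMap.id ℝ (Matrix n n ℂ)) M U₀ (Φ : TDir d n M)) with hG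
  have hGc : ContDiffAt ℝ 2 G 0 := by
    have hQ := contDiffAt_levelQ (d := d) (n := n) (m := 2) (M' := N) hL k hU₀u hU₀P' hx hls hU₀x
    have hQ' : ContDiffAt ℝ 2 (fun Φ : TDir d n M => levelQ L N k U₀ (chart (ContinuousLinearMap.id ℝ (Matrix n n ℂ)) M U₀ Φ))
        ((skewSub d n M).subtypeL 0) := by
      rw [map_zero]; exact hQ
    exact hQ'.comp (0 : ↥(skewSub d n M)) (skewSub d n M).subtypeL.contDiff.contDiffAt
  have hQs := hasStrictFDerivAt_levelQ (d := d) (n := n) (M' := N) hL k hU₀u hU₀P' hx hls hU₀x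
  set f' := (levelQ' L N k U₀).comp (skewSub d n M).subtypeL with hf'
  have hGd : HasFDerivAt G f' 0 := by
    have h := HasStrictFDerivAt.comp (0 : ↥(skewSub d n M)) (by simpa using hQs) ((skewSub d n M).subtypeL).hasStrictFDerivAt
    exact h.hasFDerivAt
  have hrange : f'.range = ⊤ := by
    refine LinearMap.range_eq_top.mpr fun γ => ?_
    obtain ⟨Φ, hΦs, hΦ⟩ := levelQ'_onto (d := d) (n := n) (M' := N) hL k hU₀u hU₀P' hx hls hU₀x γ
    exact ⟨⟨Φ, mem_skewSub.mpr hΦs⟩, by simpa [hf'] using hΦ⟩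
  have hG0 : G 0 = 0 := by
    simp only [hG, Submodule.coe_zero, chart_zero, levelQ_self]
  -- a continuous linear right inverse `R` of the differential
  obtain ⟨Rl, hRl⟩ := (f' : ↥(skewSub d n M) →ₗ[ℝ] ↥(skewSub d n N)).exists_rightInverse_of_surjective
    (by simpa using hrange)
  set R : ↥(skewSub d n N) →L[ℝ] ↥(skewSub d n M) := LinearMap.toContinuousLinearMap Rl with hRdef
  have hR : ∀ w : ↥(skewSub d n N), f' (R w) = w := fun w => by
    have h := LinearMap.congr_fun hRl w
    simpa [hRdef] using h
  -- the implicit equation `F((y,Φ),w) = Q̄(Φ + Rw) − y` on `(skewSub N × skewSub M) × skewSub N`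
  set A : ((↥(skewSub d n N) × ↥(skewSub d n M)) × ↥(skewSub d n N)) →L[ℝ] ↥(skewSub d n M) :=
    (ContinuousLinearMap.snd ℝ ↥(skewSub d n N) ↥(skewSub d n M)).comp
        (ContinuousLinearMap.fst ℝ (↥(skewSub d n N) × ↥(skewSub d n M)) ↥(skewSub d n N))
      + R.comp (ContinuousLinearMap.snd ℝ (↥(skewSub d n N) × ↥(skewSub d n M)) ↥(skewSub d n N)) with hAdef
  set B : ((↥(skewSub d n N) × ↥(skewSub d n M)) × ↥(skewSub d n N)) →L[ℝ] ↥(skewSub d n N) :=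
    (ContinuousLinearMap.fst ℝ ↥(skewSub d n N) ↥(skewSub d n M)).comp
      (ContinuousLinearMap.fst ℝ (↥(skewSub d n N) × ↥(skewSub d n M)) ↥(skewSub d n N)) with hBdef
  set F : ((↥(skewSub d n N) × ↥(skewSub d n M)) × ↥(skewSub d n N)) → ↥(skewSub d n N) := fun q => G (A q) - B q with hFdef
  have hA0 : A 0 = 0 := map_zero A
  have hFc : ContDiffAt ℝ 2 F 0 := by
    have hGc' : ContDiffAt ℝ 2 G (A 0) := by rw [hA0]; exact hGc
    have h1 : ContDiffAt ℝ 2 (fun q : (↥(skewSub d n N) × ↥(skewSub d n M)) × ↥(skewSub d n N) => G (A q)) 0 :=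
      hGc'.comp 0 A.contDiff.contDiffAt
    exact h1.sub B.contDiff.contDiffAt
  have hFd : HasFDerivAt F (f'.comp A - B) 0 := by
    have hG' : HasFDerivAt G f' (A 0) := by rw [hA0]; exact hGd
    exact (hG'.comp 0 A.hasFDerivAt).sub B.hasFDerivAt
  have hfd : fderiv ℝ F 0 = f'.comp A - B := hFd.fderiv
  have hid : (fderiv ℝ F 0).comp (ContinuousLinearMap.inr ℝ (↥(skewSub d n N) × ↥(skewSub d n M)) ↥(skewSub d n N))
      = ContinuousLinearMap.id ℝ ↥(skewSub d n N) := by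
    rw [hfd]
    ext w
    simp [hAdef, hBdef, hR]
  have hinv : ((fderiv ℝ F 0).comp (ContinuousLinearMap.inr ℝ (↥(skewSub d n N) × ↥(skewSub d n M)) ↥(skewSub d n N))).IsInvertible :=
    ⟨ContinuousLinearEquiv.refl ℝ ↥(skewSub d n N), by rw [hid]; rfl⟩
  -- the implicit function `ψ` and the straightening `θ(y,Φ) = Φ + R ψ(y,Φ)`
  set ψ : ↥(skewSub d n N) × ↥(skewSub d n M) → ↥(skewSub d n N) := hFc.implicitFunction two_ne_zero hinv with hψdef
  have hψ0 : ψ 0 = 0 := by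
    have h := hFc.implicitFunction_apply_self two_ne_zero hinv
    simpa using h
  have hψc : ContDiffAt ℝ 2 ψ 0 := by
    have h := hFc.contDiffAt_implicitFunction two_ne_zero hinv
    simpa using h
  have hF0 : F 0 = 0 := by
    have h : G (A 0) - B 0 = 0 := by rw [hA0, hG0, map_zero, sub_zero]
    exact h
  have hev1 : ∀ᶠ p : ↥(skewSub d n N) × ↥(skewSub d n M) in 𝓝 0, F (p, ψ p) = 0 := by
    have h := hFc.eventually_apply_implicitFunction two_ne_zero hinv
    rw [hF0] at h
    simpa using h
  have hev2 : ∀ᶠ v : (↥(skewSub d n N) × ↥(skewSub d n M)) × ↥(skewSub d n N) in 𝓝 0, F v = 0 ↔ ψ v.1 = v.2 := by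
    have h := hFc.eventually_apply_eq_iff_implicitFunction two_ne_zero hinv
    rw [hF0] at h
    exact h
  set θ : ↥(skewSub d n N) × ↥(skewSub d n M) → ↥(skewSub d n M) := fun p => p.2 + R (ψ p) with hθdef
  have hθ0 : θ 0 = 0 := by simp [hθdef, hψ0]
  have hθc : ContDiffAt ℝ 2 θ 0 := contDiffAt_snd.add (R.contDiff.contDiffAt.comp 0 hψc)
  -- Lipschitz on a neighbourhood
  obtain ⟨Kθ, t, ht, hLip⟩ := (hθc.of_le (by norm_num : (1 : WithTop ℕ∞) ≤ 2)).exists_lipschitzOnWith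
  -- `θ(Q̄ Φ, Φ) = Φ` eventually: `w = 0` solves the implicit equation at `((Q̄ Φ, Φ), 0)`
  have hGcont : ContinuousAt G 0 := hGc.continuousAt
  have hvt : Tendsto (fun Φ : ↥(skewSub d n M) => (((G Φ, Φ), (0 : ↥(skewSub d n N))) : (↥(skewSub d n N) × ↥(skewSub d n M)) × ↥(skewSub d n N)))
      (𝓝 0) (𝓝 0) := by
    have h1 : Tendsto G (𝓝 0) (𝓝 0) := by
      have h := hGcont.tendsto
      rwa [hG0] at h
    have h2 : Tendsto (fun Φ : ↥(skewSub d n M) => ((G Φ, Φ) : ↥(skewSub d n N) × ↥(skewSub d n M))) (𝓝 0)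
        (𝓝 ((0, 0) : ↥(skewSub d n N) × ↥(skewSub d n M))) := h1.prodMk_nhds tendsto_id
    exact h2.prodMk_nhds (tendsto_const_nhds (x := (0 : ↥(skewSub d n N))))
  have hev3 : ∀ᶠ Φ : ↥(skewSub d n M) in 𝓝 0, θ (G Φ, Φ) = Φ := by
    filter_upwards [hvt.eventually hev2] with Φ hΦ
    have hF : F ((G Φ, Φ), 0) = 0 := by simp [hFdef, hAdef, hBdef]
    have hψΦ : ψ (G Φ, Φ) = 0 := (hΦ.mp hF)
    simp [hθdef, hψΦ]
  -- the good sets in the chart parameter: class radius and decoding margin of the top average (as in `chart_fibre_quantitative`)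
  set ch : ↥(skewSub d n M) → (Site d → Fin d → (Matrix n n ℂ)ˣ) := fun Φ =>
    chart (ContinuousLinearMap.id ℝ (Matrix n n ℂ)) M U₀ (Φ : TDir d n M) with hch
  have hval0 : Tendsto (fun Φ : ↥(skewSub d n M) => (Φ : TDir d n M)) (𝓝 0) (𝓝 0) := by
    have h := continuous_subtype_val.tendsto (0 : ↥(skewSub d n M))
    rwa [Submodule.coe_zero] at h
  have hV2 : ∀ᶠ Φ : ↥(skewSub d n M) in 𝓝 0, SmallField (ch Φ) x :=
    hval0.eventually (eventually_smallField_chart (ContinuousLinearMap.id ℝ (Matrix n n ℂ)) M hU₀PM haε hU₀a)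
  have hV3' : ∀ᶠ η : TDir d n M in 𝓝 0, ∀ (r : Fin d → Fin N) (κ' : Fin d),
      ‖(((D₀ (boxVec N r) κ')⁻¹ : (Matrix n n ℂ)ˣ) : Matrix n n ℂ)
        * (cavgIter L (k + 1) (chart (ContinuousLinearMap.id ℝ (Matrix n n ℂ)) M U₀ η) (boxVec N r) κ' : Matrix n n ℂ) - 1‖ ≤ 1 / 4 := by
    refine Filter.eventually_all.mpr fun r => Filter.eventually_all.mpr fun κ' => ?_
    have hc0 := continuousAt_cavgIter_chart (d := d) (n := n) hL N k (ContinuousLinearMap.id ℝ (Matrix n n ℂ)) hU₀u hU₀P' hx hls hU₀x (boxVec N r) κ'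
    have hcn : ContinuousAt (fun η : TDir d n M =>
        ‖(((D₀ (boxVec N r) κ')⁻¹ : (Matrix n n ℂ)ˣ) : Matrix n n ℂ)
          * ((cavgIter L (k + 1) (chart (ContinuousLinearMap.id ℝ (Matrix n n ℂ)) M U₀ η) (boxVec N r) κ' : (Matrix n n ℂ)ˣ) : Matrix n n ℂ) - 1‖) 0 :=
      ((continuousAt_const.mul hc0).sub continuousAt_const).norm
    have h0 : ‖(((D₀ (boxVec N r) κ')⁻¹ : (Matrix n n ℂ)ˣ) : Matrix n n ℂ)
        * ((cavgIter L (k + 1) (chart (ContinuousLinearMap.id ℝ (Matrix n n ℂ)) M U₀ 0) (boxVec N r) κ' : (Matrix n n ℂ)ˣ) : Matrix n n ℂ) - 1‖ < 1 / 4 := by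
      rw [chart_zero, hcD, Units.inv_mul, sub_self, norm_zero]
      norm_num
    exact (hcn.eventually (gt_mem_nhds h0)).mono fun η hη => hη.le
  have hV3 : ∀ᶠ Φ : ↥(skewSub d n M) in 𝓝 0, ∀ (r : Fin d → Fin N) (κ' : Fin d),
      ‖(((D₀ (boxVec N r) κ')⁻¹ : (Matrix n n ℂ)ˣ) : Matrix n n ℂ) * (cavgIter L (k + 1) (ch Φ) (boxVec N r) κ' : Matrix n n ℂ) - 1‖ ≤ 1 / 4 :=
    hval0.eventually hV3'
  -- pulled back along `θ` (continuous at `0`, `θ 0 = 0`)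
  have hθt : Tendsto θ (𝓝 0) (𝓝 0) := by simpa [hθ0] using hθc.continuousAt.tendsto
  have htev : ∀ᶠ p : ↥(skewSub d n N) × ↥(skewSub d n M) in 𝓝 0, p ∈ t := Filter.eventually_mem_set.mpr ht
  have hgoodp : ∀ᶠ p : ↥(skewSub d n N) × ↥(skewSub d n M) in 𝓝 0, F (p, ψ p) = 0 ∧ p ∈ t ∧ SmallField (ch (θ p)) x ∧
      ∀ (r : Fin d → Fin N) (κ' : Fin d),
      ‖(((D₀ (boxVec N r) κ')⁻¹ : (Matrix n n ℂ)ˣ) : Matrix n n ℂ) * (cavgIter L (k + 1) (ch (θ p)) (boxVec N r) κ' : Matrix n n ℂ) - 1‖ ≤ 1 / 4 := by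
    filter_upwards [hev1, htev, hθt.eventually hV2, hθt.eventually hV3] with p h1 h2 h3 h4
    exact ⟨h1, h2, h3, h4⟩
  obtain ⟨r₁, hr₁, hball₁⟩ := Metric.mem_nhds_iff.mp hgoodp
  obtain ⟨r₂, hr₂, hball₂⟩ := Metric.mem_nhds_iff.mp hev3
  refine ⟨θ, Kθ, min r₁ r₂, Kθ.2, lt_min hr₁ hr₂, hθ0, hθc, ?_, ?_, ?_⟩
  · -- Lipschitz on the ball
    intro p q hp hq
    have hp' : p ∈ t := (hball₁ (mem_ball_zero_iff.mpr (hp.trans_le (min_le_left _ _)))).2.1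
    have hq' : q ∈ t := (hball₁ (mem_ball_zero_iff.mpr (hq.trans_le (min_le_left _ _)))).2.1
    have h := hLip.dist_le_mul p hp' q hq'
    rwa [dist_eq_norm, dist_eq_norm] at h
  · -- `θ(Q̄ Φ, Φ) = Φ`
    intro Φ hΦ
    have h : θ (G Φ, Φ) = Φ := hball₂ (mem_ball_zero_iff.mpr (hΦ.trans_le (min_le_right _ _)))
    exact h
  · intro p hp
    obtain ⟨hFp, -, hΦx, hΦnear⟩ := hball₁ (mem_ball_zero_iff.mpr (hp.trans_le (min_le_left _ _)))
    -- `Q̄(θ p) = p.1`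
    have hQ : G (θ p) = p.1 := by
      have h : G (A (p, ψ p)) - B (p, ψ p) = 0 := hFp
      have hA : A (p, ψ p) = θ p := by simp [hAdef, hθdef]
      have hB : B (p, ψ p) = p.1 := by simp [hBdef]
      rw [hA, hB, sub_eq_zero] at h
      exact h
    -- class membership of `chart(θ p)`
    have hΦs : (θ p : TDir d n M) ∈ skewSub d n M := (θ p).2
    have hchu : IsUnitaryCfg (ch (θ p)) := by
      show IsUnitaryCfg (chart (ContinuousLinearMap.id ℝ (Matrix n n ℂ)) M U₀ (θ p : TDir d n M))
      rw [chart_id_eq_chart_skewP U₀ hΦs]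
      exact isUnitaryCfg_chart M hU₀u _
    have hchP : IsPeriodicCfg (ch (θ p)) ((N * L ^ (k + 1) : ℕ) : ℤ) := by
      rw [ePM]
      exact isPeriodicCfg_chart (ContinuousLinearMap.id ℝ (Matrix n n ℂ)) M hU₀PM _
    have hmem : ch (θ p) ∈ sfClass d L N ε (k + 1) := ⟨hchu, hchP, hΦx⟩
    refine ⟨by exact hQ, hmem, fun D hDu hDP hDnear hy => ⟨hmem, ?_⟩⟩
    -- decoding of the top average
    have hchPt : IsPeriodicCfg (ch (θ p)) ((tower L N (k + 1) : ℕ) : ℤ) := by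
      rw [natCast_tower_succ, ← eP]; exact hchP
    obtain ⟨hXu, -, -⟩ := cavgIter_unitary_small hL k hchu hx hls hΦx
    have hXP : IsPeriodicCfg (cavgIter L (k + 1) (ch (θ p))) (N : ℤ) := isPeriodicCfg_cavgIter L N (k + 1) hchPt
    have hQ' : skewPR N (relLog N (cavgIter L (k + 1) U₀) (cavgIter L (k + 1) (ch (θ p)))) = skewPR N (relLog N D₀ D) := by
      rw [hy]; exact (by exact hQ : levelQ L N k U₀ (ch (θ p)) = p.1)
    rw [hcD] at hQ'
    have heq : cavgIter L (k + 1) (ch (θ p)) = D := eq_of_skewPR_relLog_eq hXP hDP hD₀u hXu hDu hΦnear hDnear hQ'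
    rw [← cavgIter_eq_avgIter]
    exact heq

end

end Summit.QuantumFields.BalabanUV.T4Continuum.NE7FibreStraightening
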